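import Mathlib
import Literature.Analysis.FunctionSpaces.PoissonPointProcess
import Literature.Analysis.FunctionSpaces.PoissonMecke
import Literature.Analysis.FunctionSpaces.PoissonMeckeProofs
import Literature.Analysis.FunctionSpaces.PointConfigFactorialMeasure
import Summits.CriticalPhenomena.CardyFormulaZ2.Theorems.CardyFlipRussoSquareFromVoronoiHubSmallCellsPart1

/-!
# Stub `stub_noDefect` (S2 of K1), line `Sketch` of crux `SquareFromVoronoiHub` — Part 1:
# first moments of tuples of distinct Poisson nuclei, and the geometry of short pseudo-edges

Crux `Summit.CriticalPhenomena.CardyFormulaZ2.Theses.CardyFlipRusso.SquareFromVoronoiHub`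
(stmt-CriticalPhenomena-6434), line `Sketch` (card `voronoi-blocks-on-fixed-gs`), stub family K1
("faithful discretisation"), registered stub `stub_noDefect` (the bulk no-defect event of the
dilated Poisson–Voronoi nuclei has probability `→ 1`); registered sub-goal `stub_noDefect_part1`.
This file supplies the two model-free inputs of the first-moment method (Bollobás–Riordan,
*Percolation* (2006), Ch. 8 §8.3: "bad events" of the fine discretisation are unions over tuples
of nuclei, controlled by their expected number):

* `measure_setOf_exists_tuples_le` — **Markov + multivariate Mecke**: for a Poisson process `P`
  of σ-finite intensity `ν` and a measurable set `T` of `m`-tuples, the probability that SOME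
  `m`-tuple of distinct nuclei lies in `T` is at most `ν^{⊗m}(T)` (the mean number of such tuples,
  Last–Penrose (2017) Thm 4.4 with a configuration-independent integrand, i.e. the `m`-th
  factorial moment measure; measurability of the tuple count is
  `PointConfig.measurable_tsum_tuples`);
* `lintegral_pi_fin_two`, `lintegral_pi_fin_four` — Tonelli on `E²`, `E⁴` in the `![…]` form;
* the **short pseudo-edge set** `quadSet a l` of quadruples `(x₀, x₁, x₂, x₃)` such that
  `x₀, x₁, x₂` have a common centre `v` and `x₀, x₁, x₃` a common centre `v'`, both within `2a`
  of `x₀`, with `|vv'| ≤ l`: it is CLOSED (`isClosed_quadSet`: projection along the compact factor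
  of the two centres), its windowed version `quadWindow L a l` is measurable, and its
  `x₃`-sections are thin annuli (`quadWindow_section`: the centre of three distinct points is
  unique, `EuclideanGeometry.eq_of_dist_eq_of_dist_eq_of_finrank_eq_two`) of area `≤ 25π a l`
  (`volume_annulus_le`), whence `lintegral_quadWindow_section_le`: the `x₃`-integral of the
  indicator against `2 · Lebesgue` is `≤ 50π a l` and vanishes unless `x₀ ∈ B(0, L)`,
  `x₁, x₂ ∈ B(x₀, 5a)`.

References: G. Last, M. Penrose, *Lectures on the Poisson Process* (2017), Thm 4.4;
B. Bollobás, O. Riordan, *Percolation* (2006), Ch. 8 §8.3.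
-/

noncomputable section

namespace Summit.CriticalPhenomena.CardyFormulaZ2.Cruxes.SquareFromVoronoiHub.VoronoiBlocks.Faithful.NoDefect

open scoped Topology ENNReal
open Set Filter MeasureTheory Metric
open Literature.Analysis.FunctionSpaces (PointConfig IsPoissonPointProcess)

/-! ### Tonelli on `E²` and `E⁴` -/

section Iterated

variable {E : Type*} [MeasurableSpace E]

/-- Tonelli on `E²`: integration against `ν ⊗ ν` on `Fin 2 → E` is the iterated integral of
`g ![a, b]` (`measurePreserving_piFinSuccAbove`, twice). [folklore] -/
theorem lintegral_pi_fin_two (ν : Measure E) [SigmaFinite ν] {g : (Fin 2 → E) → ℝ≥0∞}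
    (hg : Measurable g) :
    ∫⁻ x, g x ∂(Measure.pi fun _ : Fin 2 => ν) = ∫⁻ a, ∫⁻ b, g ![a, b] ∂ν ∂ν := by
  rw [IsPoissonPointProcess.lintegral_pi_succ_eq_lintegral_lintegral_cons ν 1 hg]
  refine lintegral_congr fun a => ?_
  have hga : Measurable fun y : Fin 1 → E => g (Fin.cons a y) :=
    hg.comp (PointConfig.measurable_finCons measurable_const measurable_id)
  rw [IsPoissonPointProcess.lintegral_pi_succ_eq_lintegral_lintegral_cons ν 0 hga]
  refine lintegral_congr fun b => ?_
  rw [Measure.pi_of_empty, lintegral_dirac' _ Subsingleton.measurable]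
  congr 1

/-- Tonelli on `E⁴`: integration against `ν^{⊗4}` on `Fin 4 → E` is the fourfold iterated integral
of `g ![a, b, c, d]`. [folklore] -/
theorem lintegral_pi_fin_four (ν : Measure E) [SigmaFinite ν] {g : (Fin 4 → E) → ℝ≥0∞}
    (hg : Measurable g) :
    ∫⁻ x, g x ∂(Measure.pi fun _ : Fin 4 => ν) =
      ∫⁻ a, ∫⁻ b, ∫⁻ c, ∫⁻ d, g ![a, b, c, d] ∂ν ∂ν ∂ν ∂ν := by
  rw [IsPoissonPointProcess.lintegral_pi_succ_eq_lintegral_lintegral_cons ν 3 hg]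
  refine lintegral_congr fun a => ?_
  have hga : Measurable fun y : Fin 3 → E => g (Fin.cons a y) :=
    hg.comp (PointConfig.measurable_finCons measurable_const measurable_id)
  rw [IsPoissonPointProcess.lintegral_pi_succ_eq_lintegral_lintegral_cons ν 2 hga]
  refine lintegral_congr fun b => ?_
  have hgab : Measurable fun y : Fin 2 → E => g (Fin.cons a (Fin.cons b y)) :=
    hga.comp (PointConfig.measurable_finCons measurable_const measurable_id)
  rw [IsPoissonPointProcess.lintegral_pi_succ_eq_lintegral_lintegral_cons ν 1 hgab]
  refine lintegral_congr fun c => ?_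
  have hgabc : Measurable fun y : Fin 1 → E => g (Fin.cons a (Fin.cons b (Fin.cons c y))) :=
    hgab.comp (PointConfig.measurable_finCons measurable_const measurable_id)
  rw [IsPoissonPointProcess.lintegral_pi_succ_eq_lintegral_lintegral_cons ν 0 hgabc]
  refine lintegral_congr fun d => ?_
  rw [Measure.pi_of_empty, lintegral_dirac' _ Subsingleton.measurable]
  congr 1

end Iterated

/-! ### The first-moment method for tuples of distinct nuclei -/

section FirstMoment

variable {E : Type*} [TopologicalSpace E] [T2Space E] [SecondCountableTopology E]
  [SigmaCompactSpace E] [MeasurableSpace E] [BorelSpace E]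

/-- **First-moment bound for tuples of distinct nuclei** (Markov's inequality and the multivariate
Mecke equation, Last–Penrose (2017) Thm 4.4, with the configuration-independent integrand `1_T`):
for a Poisson process of σ-finite intensity `ν` and a measurable set `T` of `m`-tuples,
`P {some m-tuple of distinct nuclei lies in T} ≤ E #{such tuples} = ν^{⊗m}(T)`.  The tuple count
`c ↦ ∑_{x ∈ tuples m c} 1_T(x)` is measurable by `PointConfig.measurable_tsum_tuples`.
[cite: LastPenrose2017, Thm 4.4] -/
theorem measure_setOf_exists_tuples_le {ν : Measure E} [SigmaFinite ν] {P : Measure (PointConfig E)}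
    (h : IsPoissonPointProcess ν P) {m : ℕ} {T : Set (Fin m → E)} (hT : MeasurableSet T) :
    P {c | ∃ x ∈ PointConfig.tuples m c, x ∈ T} ≤ Measure.pi (fun _ : Fin m => ν) T := by
  haveI := h.isProbabilityMeasure
  set N : PointConfig E → ℝ≥0∞ := fun c =>
    ∑' x : PointConfig.tuples m c, T.indicator (1 : (Fin m → E) → ℝ≥0∞) (x : Fin m → E) with hN
  have hNm : Measurable N :=
    PointConfig.measurable_tsum_tuples ((measurable_one.indicator hT).comp measurable_snd)
  have hsub : {c : PointConfig E | ∃ x ∈ PointConfig.tuples m c, x ∈ T} ⊆ {c | 1 ≤ N c} := by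
    rintro c ⟨x, hx, hxT⟩
    change 1 ≤ ∑' y : PointConfig.tuples m c, T.indicator (1 : (Fin m → E) → ℝ≥0∞) (y : Fin m → E)
    calc (1 : ℝ≥0∞) = T.indicator (1 : (Fin m → E) → ℝ≥0∞) x := by rw [indicator_of_mem hxT]; rfl
      _ ≤ ∑' y : PointConfig.tuples m c, T.indicator (1 : (Fin m → E) → ℝ≥0∞) (y : Fin m → E) :=
          ENNReal.le_tsum (⟨x, hx⟩ : PointConfig.tuples m c)
  have hMecke : ∫⁻ c, N c ∂P = Measure.pi (fun _ : Fin m => ν) T := by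
    have hh : Measurable fun p : (Fin m → E) × PointConfig E =>
        T.indicator (1 : (Fin m → E) → ℝ≥0∞) p.1 :=
      (measurable_one.indicator hT).comp measurable_fst
    have key : ∫⁻ c, N c ∂P = ∫⁻ x, ∫⁻ _c, T.indicator (1 : (Fin m → E) → ℝ≥0∞) x ∂P
        ∂(Measure.pi fun _ : Fin m => ν) :=
      IsPoissonPointProcess.multivariateMecke_holds h m _ hh
    rw [key]
    simp only [lintegral_const, measure_univ, mul_one]
    exact lintegral_indicator_one hT
  calc P {c | ∃ x ∈ PointConfig.tuples m c, x ∈ T} ≤ P {c | 1 ≤ N c} := measure_mono hsub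
    _ = 1 * P {c | 1 ≤ N c} := (one_mul _).symm
    _ ≤ ∫⁻ c, N c ∂P := mul_meas_ge_le_lintegral₀ hNm.aemeasurable 1
    _ = _ := hMecke

end FirstMoment

/-! ### Short pseudo-edges: the quadruple set, its closedness and its thin sections -/

/-- The short pseudo-edge configurations of four nuclei at cell radius `a` and edge threshold `l`:
`x₀, x₁, x₂` have a common centre `v` and `x₀, x₁, x₃` a common centre `v'`, both within `2a` of
`x₀`, with `|vv'| ≤ l`. [folklore] -/
def quadSet (a l : ℝ) : Set (Fin 4 → ℂ) :=
  {x | ∃ v v' : ℂ, dist (x 0) v = dist (x 1) v ∧ dist (x 1) v = dist (x 2) v ∧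
    dist (x 0) v ≤ 2 * a ∧ dist (x 0) v' = dist (x 1) v' ∧ dist (x 1) v' = dist (x 3) v' ∧
    dist (x 0) v' ≤ 2 * a ∧ dist v v' ≤ l}

/-- `quadSet a l` is closed: it is the projection of a closed set along the compact factor of the
two centres, written relative to `x₀`. [folklore] -/
theorem isClosed_quadSet (a l : ℝ) : IsClosed (quadSet a l) := by
  set K : Set ℂ := closedBall (0 : ℂ) (2 * a) with hK
  haveI : CompactSpace K := isCompact_iff_compactSpace.1 (isCompact_closedBall _ _)
  set Z : Set ((Fin 4 → ℂ) × (K × K)) :=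
    {p | dist (p.1 0) (p.1 0 + p.2.1) = dist (p.1 1) (p.1 0 + p.2.1)} ∩
    {p | dist (p.1 1) (p.1 0 + p.2.1) = dist (p.1 2) (p.1 0 + p.2.1)} ∩
    {p | dist (p.1 0) (p.1 0 + p.2.2) = dist (p.1 1) (p.1 0 + p.2.2)} ∩
    {p | dist (p.1 1) (p.1 0 + p.2.2) = dist (p.1 3) (p.1 0 + p.2.2)} ∩
    {p | dist (p.1 0 + (p.2.1 : ℂ)) (p.1 0 + p.2.2) ≤ l} with hZ
  have hc : ∀ i : Fin 4, Continuous fun p : (Fin 4 → ℂ) × (K × K) => p.1 i :=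
    fun i => (continuous_apply i).comp continuous_fst
  have hw : Continuous fun p : (Fin 4 → ℂ) × (K × K) => p.1 0 + (p.2.1 : ℂ) :=
    (hc 0).add (continuous_subtype_val.comp (continuous_fst.comp continuous_snd))
  have hw' : Continuous fun p : (Fin 4 → ℂ) × (K × K) => p.1 0 + (p.2.2 : ℂ) :=
    (hc 0).add (continuous_subtype_val.comp (continuous_snd.comp continuous_snd))
  have hZc : IsClosed Z := by
    refine ((((isClosed_eq ((hc 0).dist hw) ((hc 1).dist hw)).inter
      (isClosed_eq ((hc 1).dist hw) ((hc 2).dist hw))).inter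
      (isClosed_eq ((hc 0).dist hw') ((hc 1).dist hw'))).inter
      (isClosed_eq ((hc 1).dist hw') ((hc 3).dist hw'))).inter
      (isClosed_le (hw.dist hw') continuous_const)
  have himage : quadSet a l = Prod.fst '' Z := by
    ext x
    constructor
    · rintro ⟨v, v', h1, h2, h3, h4, h5, h6, h7⟩
      have hvK : v - x 0 ∈ K := by
        rw [hK, mem_closedBall_zero_iff, ← dist_eq_norm, dist_comm]; exact h3
      have hv'K : v' - x 0 ∈ K := by
        rw [hK, mem_closedBall_zero_iff, ← dist_eq_norm, dist_comm]; exact h6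
      refine ⟨(x, ⟨v - x 0, hvK⟩, ⟨v' - x 0, hv'K⟩), ?_, rfl⟩
      simp only [hZ, mem_inter_iff, mem_setOf_eq, add_sub_cancel]
      exact ⟨⟨⟨⟨h1, h2⟩, h4⟩, h5⟩, h7⟩
    · rintro ⟨⟨x', w, w'⟩, hp, rfl⟩
      simp only [hZ, mem_inter_iff, mem_setOf_eq] at hp
      obtain ⟨⟨⟨⟨h1, h2⟩, h4⟩, h5⟩, h7⟩ := hp
      have hwK : dist (x' 0) (x' 0 + (w : ℂ)) ≤ 2 * a := by
        rw [dist_self_add_right]; exact mem_closedBall_zero_iff.1 w.2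
      have hw'K : dist (x' 0) (x' 0 + (w' : ℂ)) ≤ 2 * a := by
        rw [dist_self_add_right]; exact mem_closedBall_zero_iff.1 w'.2
      exact ⟨x' 0 + w, x' 0 + w', h1, h2, hwK, h4, h5, hw'K, h7⟩
  rw [himage]
  exact isClosedMap_fst_of_compactSpace Z hZc

/-- The windowed pseudo-edge set: first nucleus in the disc `B(0, L)`, the first three nuclei
pairwise distinct, and the pseudo-edge condition `quadSet a l`. [folklore] -/
def quadWindow (L a l : ℝ) : Set (Fin 4 → ℂ) :=
  {x | x 0 ∈ ball (0 : ℂ) L ∧ x 0 ≠ x 1 ∧ x 0 ≠ x 2 ∧ x 1 ≠ x 2} ∩ quadSet a l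

/-- `quadWindow L a l` is measurable (open ∩ closed). [folklore] -/
theorem measurableSet_quadWindow (L a l : ℝ) : MeasurableSet (quadWindow L a l) := by
  refine MeasurableSet.inter (IsOpen.measurableSet ?_) (isClosed_quadSet a l).measurableSet
  simp only [setOf_and]
  have hc : ∀ i : Fin 4, Continuous fun x : Fin 4 → ℂ => x i := fun i => continuous_apply i
  exact (isOpen_ball.preimage (hc 0)).inter ((isOpen_ne_fun (hc 0) (hc 1)).inter
    ((isOpen_ne_fun (hc 0) (hc 2)).inter (isOpen_ne_fun (hc 1) (hc 2))))

/-- **The `x₃`-section of the pseudo-edge set is a thin annulus.**  If `(x₀, x₁, x₂, x₃')` is a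
windowed pseudo-edge configuration then the centre `v` of `x₀, x₁, x₂` is unique (two distinct
circles meet in at most two points, `EuclideanGeometry.eq_of_dist_eq_of_dist_eq_of_finrank_eq_two`),
and every `x₃` completing `x₀, x₁, x₂` to such a configuration lies in the annulus
`R - 2l ≤ |x₃ v| ≤ R + 2l`, `R = |x₀ v| ≤ 2a`. [folklore] -/
theorem quadWindow_section {L a l : ℝ} {x₀ x₁ x₂ x₃' : ℂ}
    (h' : (![x₀, x₁, x₂, x₃'] : Fin 4 → ℂ) ∈ quadWindow L a l) :
    x₀ ∈ ball (0 : ℂ) L ∧ ∃ v : ℂ, dist x₀ v = dist x₁ v ∧ dist x₁ v = dist x₂ v ∧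
      dist x₀ v ≤ 2 * a ∧ ∀ x₃, (![x₀, x₁, x₂, x₃] : Fin 4 → ℂ) ∈ quadWindow L a l →
        dist x₀ v - 2 * l ≤ dist x₃ v ∧ dist x₃ v ≤ dist x₀ v + 2 * l := by
  obtain ⟨⟨hL, h01, h02, h12⟩, v, v', e1, e2, hv, -, -, -, -⟩ := h'
  simp only [Matrix.cons_val_zero, Matrix.cons_val_one, Matrix.head_cons, Matrix.cons_val_two,
    Matrix.tail_cons] at hL h01 h02 h12 e1 e2 hv
  refine ⟨hL, v, e1, e2, hv, fun x₃ hx => ?_⟩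
  obtain ⟨-, w, w', f1, f2, -, f1', f2', -, hww'⟩ := hx
  simp only [Matrix.cons_val_zero, Matrix.cons_val_one, Matrix.head_cons, Matrix.cons_val_two,
    Matrix.tail_cons, Matrix.cons_val_three] at f1 f2 f1' f2' 
  have hwv : w = v := by
    by_contra hne
    rcases EuclideanGeometry.eq_of_dist_eq_of_dist_eq_of_finrank_eq_two
      Complex.finrank_real_complex hne h01 rfl f1.symm (f1.trans f2).symm rfl e1.symm
      (e1.trans e2).symm with h | h
    · exact h02 h.symm
    · exact h12 h.symm
  subst hwv
  have h3 : dist x₃ w' = dist x₀ w' := (f1'.trans f2').symm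
  have t1 := dist_triangle x₃ w w'
  have t2 := dist_triangle x₀ w' w
  have t3 := dist_triangle x₃ w' w
  have t4 := dist_triangle x₀ w w'
  have hs : dist w' w = dist w w' := dist_comm _ _
  constructor <;> linarith

/-- Area of a thin annulus: for `0 ≤ R ≤ 2a` and `0 < l ≤ a`, the annulus
`R - 2l ≤ |z v| ≤ R + 2l` has Lebesgue measure `≤ 25 π a l`. [folklore] -/
theorem volume_annulus_le {v : ℂ} {R a l : ℝ} (hR0 : 0 ≤ R) (hR : R ≤ 2 * a) (hl : 0 < l)
    (hla : l ≤ a) :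
    volume {z : ℂ | R - 2 * l ≤ dist z v ∧ dist z v ≤ R + 2 * l} ≤
      ENNReal.ofReal (25 * Real.pi * a * l) := by
  have hsub : {z : ℂ | R - 2 * l ≤ dist z v ∧ dist z v ≤ R + 2 * l} ⊆
      ball v (R + 3 * l) \ ball v (R - 2 * l) := by
    rintro z ⟨hz1, hz2⟩
    refine ⟨mem_ball.2 (by linarith), fun hz => ?_⟩
    rw [mem_ball] at hz
    linarith
  have hfin : volume (ball v (R + 3 * l)) ≠ ∞ := SmallCells.volume_ball_ne_top v _
  have hdiff : volume.real (ball v (R + 3 * l) \ ball v (R - 2 * l)) ≤ 25 * Real.pi * a * l := by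
    rw [measureReal_sdiff (ball_subset_ball (by linarith)) measurableSet_ball hfin,
      SmallCells.volume_real_ball v (by linarith)]
    have hpi := Real.pi_pos
    have k1 : R * l ≤ 2 * a * l := mul_le_mul_of_nonneg_right hR hl.le
    have k2 : l * l ≤ a * l := mul_le_mul_of_nonneg_right hla hl.le
    by_cases h2 : 0 ≤ R - 2 * l
    · rw [SmallCells.volume_real_ball v h2]
      have key : 0 ≤ Real.pi * (25 * a * l - 10 * R * l - 5 * l ^ 2) :=
        mul_nonneg hpi.le (by nlinarith)
      nlinarith [key]
    · push Not at h2
      rw [Metric.ball_eq_empty.2 h2.le, measureReal_empty, sub_zero]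
      have h5 : (R + 3 * l) ^ 2 ≤ (5 * l) ^ 2 := by
        apply pow_le_pow_left₀ (by linarith) (by linarith)
      have key : Real.pi * (R + 3 * l) ^ 2 ≤ Real.pi * (5 * l) ^ 2 :=
        mul_le_mul_of_nonneg_left h5 hpi.le
      have key2 : 0 ≤ Real.pi * (25 * a * l - 25 * l ^ 2) := mul_nonneg hpi.le (by nlinarith)
      nlinarith [key, key2]
  calc volume {z : ℂ | R - 2 * l ≤ dist z v ∧ dist z v ≤ R + 2 * l}
      ≤ volume (ball v (R + 3 * l) \ ball v (R - 2 * l)) := measure_mono hsub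
    _ = ENNReal.ofReal (volume.real (ball v (R + 3 * l) \ ball v (R - 2 * l))) :=
        (ofReal_measureReal (measure_ne_top_of_subset (fun _ hz => hz.1) hfin)).symm
    _ ≤ ENNReal.ofReal (25 * Real.pi * a * l) := ENNReal.ofReal_le_ofReal hdiff

/-- The intensity `2 · Lebesgue` of a disc: `(vol + vol)(B(x, r)) = 2π r²`. [folklore] -/
theorem volume_add_volume_ball (x : ℂ) {r : ℝ} (hr : 0 ≤ r) :
    (volume + volume : Measure ℂ) (ball x r) = ENNReal.ofReal (2 * Real.pi * r ^ 2) := by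
  rw [Measure.add_apply, ← ofReal_measureReal (SmallCells.volume_ball_ne_top x r),
    SmallCells.volume_real_ball x hr, ← ENNReal.ofReal_add (by positivity) (by positivity)]
  ring_nf

/-- **The `x₃`-integral of the windowed pseudo-edge indicator is `O(a l)`**, and vanishes unless
`x₀ ∈ B(0, L)` and `x₁, x₂ ∈ B(x₀, 5a)`. [folklore] -/
theorem lintegral_quadWindow_section_le {L a l : ℝ} (ha : 0 < a) (hl : 0 < l) (hla : l ≤ a)
    (x₀ x₁ x₂ : ℂ) :
    ∫⁻ x₃, (quadWindow L a l).indicator (1 : (Fin 4 → ℂ) → ℝ≥0∞) ![x₀, x₁, x₂, x₃]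
        ∂(volume + volume : Measure ℂ) ≤
      ((ball (0 : ℂ) L).indicator 1 x₀ * (ball x₀ (5 * a)).indicator 1 x₁) *
        ((ball x₀ (5 * a)).indicator 1 x₂ * ENNReal.ofReal (50 * Real.pi * a * l)) := by
  by_cases hex : ∃ x₃, (![x₀, x₁, x₂, x₃] : Fin 4 → ℂ) ∈ quadWindow L a l
  · obtain ⟨x₃', h'⟩ := hex
    obtain ⟨hL, v, e1, e2, hv, hsec⟩ := quadWindow_section h'
    have h1 : x₁ ∈ ball x₀ (5 * a) := by
      rw [mem_ball']
      have := dist_triangle x₀ v x₁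
      rw [dist_comm v x₁, ← e1] at this
      linarith
    have h2 : x₂ ∈ ball x₀ (5 * a) := by
      rw [mem_ball']
      have := dist_triangle x₀ v x₂
      rw [dist_comm v x₂, ← e2, ← e1] at this
      linarith
    rw [indicator_of_mem hL, indicator_of_mem h1, indicator_of_mem h2]
    simp only [Pi.one_apply, one_mul]
    set A : Set ℂ := {z | dist x₀ v - 2 * l ≤ dist z v ∧ dist z v ≤ dist x₀ v + 2 * l} with hA
    have hAm : MeasurableSet A :=
      measurableSet_Icc.preimage (continuous_id.dist continuous_const).measurable
    have hAvol : volume A ≤ ENNReal.ofReal (25 * Real.pi * a * l) :=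
      volume_annulus_le dist_nonneg hv hl hla
    calc ∫⁻ x₃, (quadWindow L a l).indicator (1 : (Fin 4 → ℂ) → ℝ≥0∞) ![x₀, x₁, x₂, x₃]
          ∂(volume + volume : Measure ℂ)
        ≤ ∫⁻ x₃, A.indicator 1 x₃ ∂(volume + volume : Measure ℂ) := by
          refine lintegral_mono fun x₃ => ?_
          by_cases hx : (![x₀, x₁, x₂, x₃] : Fin 4 → ℂ) ∈ quadWindow L a l
          · rw [indicator_of_mem hx, indicator_of_mem (show x₃ ∈ A from hsec x₃ hx)]
            exact le_rfl
          · rw [indicator_of_notMem hx]; exact bot_le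
      _ = (volume + volume : Measure ℂ) A := lintegral_indicator_one hAm
      _ ≤ ENNReal.ofReal (25 * Real.pi * a * l) + ENNReal.ofReal (25 * Real.pi * a * l) := by
          rw [Measure.add_apply]; exact add_le_add hAvol hAvol
      _ = ENNReal.ofReal (50 * Real.pi * a * l) := by
          rw [← ENNReal.ofReal_add (by positivity) (by positivity)]; ring_nf
  · push Not at hex
    have h0 : ∀ x₃, (quadWindow L a l).indicator (1 : (Fin 4 → ℂ) → ℝ≥0∞) ![x₀, x₁, x₂, x₃] = 0 :=
      fun x₃ => indicator_of_notMem (hex x₃) _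
    simp only [h0, lintegral_zero]
    exact bot_le


/-! ### Registered sub-goal of the stub (Part 1) -/

/-- **Part 1 of stub `stub_noDefect`, registered sub-goal** (`--supports stmt-CriticalPhenomena-6434`):
the first-moment bound `measure_setOf_exists_tuples_le` as a closed statement — the probability
that some `m`-tuple of distinct nuclei of a Poisson process lies in a measurable set `T` is at most
`ν^{⊗m}(T)`. [cite: LastPenrose2017, Thm 4.4] -/
theorem stub_noDefect_part1 : ∀ {E : Type*} [TopologicalSpace E] [T2Space E]
    [SecondCountableTopology E] [SigmaCompactSpace E] [MeasurableSpace E] [BorelSpace E]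
    {ν : Measure E} [SigmaFinite ν] {P : Measure (PointConfig E)}, IsPoissonPointProcess ν P →
    ∀ {m : ℕ} {T : Set (Fin m → E)}, MeasurableSet T →
    P {c | ∃ x ∈ PointConfig.tuples m c, x ∈ T} ≤ Measure.pi (fun _ : Fin m => ν) T :=
  fun h _ _ hT => measure_setOf_exists_tuples_le h hT

end Summit.CriticalPhenomena.CardyFormulaZ2.Cruxes.SquareFromVoronoiHub.VoronoiBlocks.Faithful.NoDefect

end
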